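import Summits.NavierStokesRegularity.NavierStokesRegularity.Theses.SymmetryModuliCount
import Summits.NavierStokesRegularity.NavierStokesRegularity.Theorems.SymmetryModuliCountLinearLiouvilleSevenHarmonicLinearGrowth
import Summits.NavierStokesRegularity.NavierStokesRegularity.Theorems.SymmetryModuliCountLinearLiouvilleSevenCaloricSliceLipschitz
import Summits.NavierStokesRegularity.NavierStokesRegularity.Theorems.SymmetryModuliCountLinearLiouvilleSevenAnchorPressure
import Literature.Analysis.FluidPDE.TemperedLinearisedNSParasitic
import Literature.Analysis.FluidPDE.TypeIAncientMild
import HarnessLib.Audit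

/-!
# Skeleton line `galilean-collapse` for crux `LinearLiouvilleSeven` (stmt-NavierStokesRegularity-4054)

Route `SymmetryModuliCount`, sub-problem `NavierStokesRegularity` (Clay A, positive side). Crux-plan
skeleton (planner `cruxplan-stmt-NavierStokesRegularity-4054-galilean-collapse`, round 1, idea card
`Cruxes/LinearLiouvilleSeven/Ideas/galilean-collapse.md`, triage `TRIAGE-r1-1.md`: pass), reshaped by the
first lead (`prover-line-…-4054-lean-0`, 2026-08-16: anchor cut into A1/A2/A3a + assembly) and by the
re-seated lead (`prover-line-…-4054-r-0`, 2026-08-16, this file).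

**Stubs, third reshape (2026-08-16, lead r-0).**
* CLOSED (landed `--supports 4054`, imported above, no `sorry` left here): A1
  `Theorems.stub_harmonicLinearGrowthGradient` (p72234), A2 `Theorems.stub_caloricSliceLipschitz` (p72133),
  A3a `Theorems.stub_anchorPressure` (p72245).
* OPEN, Part A (the crux proof): `stub_anchorGradientCaloric` (C1, worker), `stub_anchorAssembly` (A3,
  lead) — together the `u = 0` ANCHOR `TemperedStokesLiouvilleStokes`; `stub_typeIAncientLiouville` (the
  idea's TRANSFER `C⁺ = X =` route target `SymmetryModuliCount.TypeIAncientLiouville`, stmt-4050, open).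
* OPEN, Part B (the collapse `LL7 → X`, structural): `stub_galileanModeRegular` (B2a),
  `stub_galileanModeMomentum` (B2b), `stub_sevenIndependentModulations` (B3),
  `stub_sliceConstantModesForceFlat` (B4); the KNSS gauge bounds (B1) stay the named Prop `GaugeBounds`.
The sorry-free composition `LinearLiouvilleSeven_of` concludes the crux decl
`Summit.NavierStokesRegularity.NavierStokesRegularity.Theses.SymmetryModuliCount.LinearLiouvilleSeven`
BY NAME (and is the only theorem of the file doing so).

## The line in one paragraph (Part A)

`X ⇒ LL7`: if every element `u` of the Type-I ancient mild class `𝒜_C` vanishes on `t < 0` (`X`), the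
linearised system about `u` IS the Stokes system there (`temperedLinearised_of_background_eq_zero`), so
each of the seven tempered pairs `(vᵢ, qᵢ)` is a tempered classical ancient STOKES solution, hence
slice-wise constant by the anchor; the combination `c = δ₀` is then slice-constant: `LL7`.

## The anchor (lead's plan, "translation differences"; no heat kernel, no time antiderivative)

For a tempered ancient Stokes pair `(v, q)` (`‖v‖ ≤ K/√(−t) + K(1+‖x‖)/(−t)`,
`|q| ≤ K/(−t) + K(1+‖x‖)/√(−t)³`, `div v = 0`, `∂ₜv = Δv − ∇q`):
(P) `∇q(t,·) = γ(t)` is slice-constant (A3a, from A1). (S1) For fixed `h, e` the scalar field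
`W_h = ⟪v(t,x+h) − v(t,x), e⟫` is ancient caloric (the constant `γ` cancels) of linear growth with slope
`2K/(−t₀)` on `t ≤ t₀`, so by A2 the slice `W_h(t₀,·)` is `44K/(−t₀)`-Lipschitz, uniformly in `h`;
hence `|w(t,x+h) − w(t,x)| ≤ 44K/(−t)` for the entries `w = ⟪Dv(t,x)a, b⟫` (unit `a, b`). (S2) Each `w` is
ancient caloric (C1: `∂ₜ` and `D` commute, `DΔ = ΔD`, `Dγ = 0`), so `d_h = w(t,x+h) − w(t,x)` is a
BOUNDED ancient caloric function on `t ≤ t₀`: by A2 with slope `0` it is slice-constant,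
`w(t,x+h) − w(t,x) = w(t,h) − w(t,0)`. (S3) A function with additive, bounded increments is constant:
`n(w(t,h) − w(t,0)) = w(t,nh) − w(t,0)` is bounded in `n`. So `Dv(t,·) ≡ M(t)`, `v(t,·)` is affine, and the
growth bound gives `‖M(t)‖ ≤ K/(−t)`. (S4) `w(t,·)` constant ⇒ `Δw = 0` ⇒ `∂ₜw = 0` ⇒ `M` is constant on
`(−∞,0)` and tends to `0` as `t → −∞`: `M ≡ 0`, `v` slice-constant. ∎

## Part B (the idea's theorem): why the transfer stub is the route target and nothing smaller

The generalised-Galilean (Boisvert) covariance of Navier–Stokes, differentiated at the identity along a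
modulated translation `β(t) = φ(t) e`, gives for every classical pair `(u, p)` the exact tempered
solutions `v_φ = φ' e − φ ∂ₑu`, `q_φ = −φ'' ⟪e, x⟫ − φ ∂ₑp` of the linearised system (B2). Feeding
seven of them with independent tempered modulations (B3) into `LL7` forces `∂ₑu ≡ 0` (B4) for every `e`,
and the KNSS gauge kills flat elements (`eq_zero_of_fderiv_eq_zero`, proved). Hence
`typeIAncientLiouville_of_linearLiouvilleSeven : GaugeBounds → LL7 → X` and, with the anchor,
`GaugeBounds → (LL7 ↔ X)`: the crux is the target in costume; the number 7 is immaterial.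

## Disproof used

`Cruxes/LinearLiouvilleSeven/Disproof.lean` v1 (cdisprove, 2026-08-16): `LL7 ⇔ (X ∧ AtZero)` re-checked
(`linearLiouvilleSeven_of_typeI_of_atZero`, `atZero_of_temperedStokesSliceConstant` = this file's
Part A composition); load-bearing hypotheses at `u = 0`: the quotient by slice-constants (parasitic
modes), time-dependence of the constants, and the backward decay of the tempered class (affine modes
`Lx`) — the anchor proof above uses exactly that decay in step (S4) (`‖M(t)‖ ≤ K/(−t) → 0`). No
`-- Targets` section yet; no landed `Negative/` lemma.
-/

noncomputable section

set_option linter.dupNamespace false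

open Set Function
open scoped BigOperators InnerProductSpace RealInnerProductSpace Laplacian ContDiff
open Literature.Analysis.FluidPDE
open Summit.NavierStokesRegularity.NavierStokesRegularity.Theses.SymmetryModuliCount

namespace Summit.NavierStokesRegularity.NavierStokesRegularity.Cruxes.LinearLiouvilleSeven.GalileanCollapse

local notation "ℝ³" => EuclideanSpace ℝ (Fin 3)

/-! ## Part A — the line: anchor + transfer, composition checked -/

/-- **The crux in structured vocabulary.** `LinearLiouvilleSeven` unfolded against the tree's
`IsTypeIAncientMild` (the class `𝒜_C`) and `IsTemperedLinearisedNSSolution`; both `_iff` lemmas are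
definitional unfoldings, so this is the crux verbatim. -/
theorem linearLiouvilleSeven_iff :
    LinearLiouvilleSeven ↔
      ∀ (C : ℝ) (u : ℝ → ℝ³ → ℝ³), IsTypeIAncientMild C u →
        ∀ (v : Fin 7 → ℝ → ℝ³ → ℝ³) (q : Fin 7 → ℝ → ℝ³ → ℝ),
          (∀ i, IsTemperedLinearisedNSSolution u (v i) (q i)) →
          ∃ c : Fin 7 → ℝ, c ≠ 0 ∧ ∀ t < 0, ∃ b : ℝ³, ∀ x, ∑ i, c i • v i t x = b := by
  simp only [LinearLiouvilleSeven, isTypeIAncientMild_iff, isTemperedLinearisedNSSolution_iff]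

/-- **ANCHOR statement** (`u = 0`): a tempered classical solution `(v, q)` of the STOKES system on
`(−∞,0) × ℝ³` (= the linearised system about the zero background) is spatially constant on every
slice. Tightness: the parasitic modes `IsTemperedLinearisedNSSolution.parasitic_zero` (in tree) show
"constant", not "zero", is the right conclusion. -/
def TemperedStokesLiouville : Prop :=
  ∀ (v : ℝ → ℝ³ → ℝ³) (q : ℝ → ℝ³ → ℝ),
    IsTemperedLinearisedNSSolution (0 : ℝ → ℝ³ → ℝ³) v q → ∀ t < 0, ∃ b : ℝ³, ∀ x, v t x = b

/-- **The anchor in pure Stokes form** (verbatim the anchor stub `stub_temperedStokesLiouville` of the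
sibling lines `vortex-stretching-wall` and `backward-profile-symmetrisation`, so that ONE landed theorem
serves all three lines): hypotheses unfolded, momentum equation `∂ₜv = Δv − ∇q`. -/
def TemperedStokesLiouvilleStokes : Prop :=
  ∀ (v : ℝ → EuclideanSpace ℝ (Fin 3) → EuclideanSpace ℝ (Fin 3)) (q : ℝ → EuclideanSpace ℝ (Fin 3)
  → ℝ), ContDiffOn ℝ (⊤ : ℕ∞) (Function.uncurry v) (Set.Iio 0 ×ˢ Set.univ) → ContDiffOn ℝ (⊤ : ℕ∞)
  (Function.uncurry q) (Set.Iio 0 ×ˢ Set.univ) → (∃ K : ℝ, ∀ t < 0, ∀ x, ‖v t x‖ ≤ K / Real.sqrt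
  (-t) + K * (1 + ‖x‖) / (-t) ∧ |q t x| ≤ K / (-t) + K * (1 + ‖x‖) / Real.sqrt (-t) ^ 3) → (∀ t <
  0, Literature.Analysis.FluidPDE.VectorCalculus.IsDivFree (v t)) → (∀ t < 0, ∀ x,
  Literature.Analysis.FluidPDE.timeDeriv v t x = Laplacian.laplacian (v t) x - gradient (q t) x) →
  ∀ t < 0, ∃ b : EuclideanSpace ℝ (Fin 3), ∀ x, v t x = b

/-- **C1 statement — the velocity-gradient entries of an ancient Stokes pair with slice-constant
pressure gradient are ancient caloric functions.** For `v, q` jointly smooth on `(−∞,0) × ℝ³` with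
`∂ₜv = Δv − ∇q` and `∇q(t, x) = ∇q(t, 0)`, every entry `w(t, x) = ⟪Dv(t, x) a, b⟫` is jointly smooth
and solves `∂ₜw = Δw` classically (`∂ₜ` commutes with `D` for the jointly smooth `v`; `DΔ = ΔD`;
`D(∇q(t,·)) = 0`). -/
def AnchorGradientCaloric : Prop :=
  ∀ (v : ℝ → EuclideanSpace ℝ (Fin 3) → EuclideanSpace ℝ (Fin 3))
    (q : ℝ → EuclideanSpace ℝ (Fin 3) → ℝ),
    ContDiffOn ℝ (⊤ : ℕ∞) (Function.uncurry v) (Set.Iio 0 ×ˢ Set.univ) →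
    ContDiffOn ℝ (⊤ : ℕ∞) (Function.uncurry q) (Set.Iio 0 ×ˢ Set.univ) →
    (∀ t < 0, ∀ x, Literature.Analysis.FluidPDE.timeDeriv v t x =
      Laplacian.laplacian (v t) x - gradient (q t) x) →
    (∀ t < 0, ∀ x, gradient (q t) x = gradient (q t) 0) →
    ∀ a b : EuclideanSpace ℝ (Fin 3),
      ContDiffOn ℝ (⊤ : ℕ∞)
        (Function.uncurry fun t x => inner ℝ (fderiv ℝ (v t) x a) b) (Set.Iio 0 ×ˢ Set.univ) ∧
      ∀ t < 0, ∀ x,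
        Literature.Analysis.FluidPDE.timeDeriv (fun t x => inner ℝ (fderiv ℝ (v t) x a) b) t x =
          Laplacian.laplacian (fun x => inner ℝ (fderiv ℝ (v t) x a) b) x

/-- **Stub C1 (registered; worker-sized, S–M).** Verbatim `AnchorGradientCaloric`. -/
theorem stub_anchorGradientCaloric :
    ∀ (v : ℝ → EuclideanSpace ℝ (Fin 3) → EuclideanSpace ℝ (Fin 3))
      (q : ℝ → EuclideanSpace ℝ (Fin 3) → ℝ),
      ContDiffOn ℝ (⊤ : ℕ∞) (Function.uncurry v) (Set.Iio 0 ×ˢ Set.univ) →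
      ContDiffOn ℝ (⊤ : ℕ∞) (Function.uncurry q) (Set.Iio 0 ×ˢ Set.univ) →
      (∀ t < 0, ∀ x, Literature.Analysis.FluidPDE.timeDeriv v t x =
        Laplacian.laplacian (v t) x - gradient (q t) x) →
      (∀ t < 0, ∀ x, gradient (q t) x = gradient (q t) 0) →
      ∀ a b : EuclideanSpace ℝ (Fin 3),
        ContDiffOn ℝ (⊤ : ℕ∞)
          (Function.uncurry fun t x => inner ℝ (fderiv ℝ (v t) x a) b) (Set.Iio 0 ×ˢ Set.univ) ∧
        ∀ t < 0, ∀ x,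
          Literature.Analysis.FluidPDE.timeDeriv (fun t x => inner ℝ (fderiv ℝ (v t) x a) b) t x =
            Laplacian.laplacian (fun x => inner ℝ (fderiv ℝ (v t) x a) b) x := by
  sorry

/-- **Stub A3 (registered; held by the lead): the anchor assembly** — steps (P), (S1)–(S4) of the
plan in the module docstring, from the landed inputs A1 (`Theorems.stub_harmonicLinearGrowthGradient`),
A2 (`Theorems.stub_caloricSliceLipschitz`), A3a (`Theorems.stub_anchorPressure`) and the registered
stub C1 (first hypothesis, verbatim `AnchorGradientCaloric`). Signature =
`AnchorGradientCaloric → TemperedStokesLiouvilleStokes`, spelled out. -/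
theorem stub_anchorAssembly :
    (∀ (v : ℝ → EuclideanSpace ℝ (Fin 3) → EuclideanSpace ℝ (Fin 3))
      (q : ℝ → EuclideanSpace ℝ (Fin 3) → ℝ),
      ContDiffOn ℝ (⊤ : ℕ∞) (Function.uncurry v) (Set.Iio 0 ×ˢ Set.univ) →
      ContDiffOn ℝ (⊤ : ℕ∞) (Function.uncurry q) (Set.Iio 0 ×ˢ Set.univ) →
      (∀ t < 0, ∀ x, Literature.Analysis.FluidPDE.timeDeriv v t x =
        Laplacian.laplacian (v t) x - gradient (q t) x) →
      (∀ t < 0, ∀ x, gradient (q t) x = gradient (q t) 0) →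
      ∀ a b : EuclideanSpace ℝ (Fin 3),
        ContDiffOn ℝ (⊤ : ℕ∞)
          (Function.uncurry fun t x => inner ℝ (fderiv ℝ (v t) x a) b) (Set.Iio 0 ×ˢ Set.univ) ∧
        ∀ t < 0, ∀ x,
          Literature.Analysis.FluidPDE.timeDeriv (fun t x => inner ℝ (fderiv ℝ (v t) x a) b) t x =
            Laplacian.laplacian (fun x => inner ℝ (fderiv ℝ (v t) x a) b) x) →
    ∀ (v : ℝ → EuclideanSpace ℝ (Fin 3) → EuclideanSpace ℝ (Fin 3)) (q : ℝ → EuclideanSpace ℝ (Fin 3)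
    → ℝ), ContDiffOn ℝ (⊤ : ℕ∞) (Function.uncurry v) (Set.Iio 0 ×ˢ Set.univ) → ContDiffOn ℝ (⊤ : ℕ∞)
    (Function.uncurry q) (Set.Iio 0 ×ˢ Set.univ) → (∃ K : ℝ, ∀ t < 0, ∀ x, ‖v t x‖ ≤ K / Real.sqrt
    (-t) + K * (1 + ‖x‖) / (-t) ∧ |q t x| ≤ K / (-t) + K * (1 + ‖x‖) / Real.sqrt (-t) ^ 3) → (∀ t <
    0, Literature.Analysis.FluidPDE.VectorCalculus.IsDivFree (v t)) → (∀ t < 0, ∀ x,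
    Literature.Analysis.FluidPDE.timeDeriv v t x = Laplacian.laplacian (v t) x - gradient (q t) x) →
    ∀ t < 0, ∃ b : EuclideanSpace ℝ (Fin 3), ∀ x, v t x = b := by
  sorry

/-- **The anchor in Stokes form, from the registered stubs** (C1 → A3). -/
theorem temperedStokesLiouvilleStokes : TemperedStokesLiouvilleStokes :=
  stub_anchorAssembly stub_anchorGradientCaloric

/-- The anchor in Stokes form gives the anchor about the zero background (both convective terms
vanish identically: `(0·∇)v = Dv[0] = 0`, `(v·∇)0 = D0[v] = 0`). Pure rewriting. -/
theorem temperedStokesLiouville_of_stokes (h : TemperedStokesLiouvilleStokes) :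
    TemperedStokesLiouville := by
  intro v q hvq t ht
  obtain ⟨hv, hq, hK, hdiv, heq⟩ := hvq
  refine h v q hv hq hK hdiv (fun t' ht' x => ?_) t ht
  have e := heq t' ht' x
  simpa [convect] using e

/-- **Stub 1 of the planner's skeleton (anchor), now a THEOREM of the registered stubs.** -/
theorem stub_temperedStokesLiouville : TemperedStokesLiouville :=
  temperedStokesLiouville_of_stokes temperedStokesLiouvilleStokes

/-- **Stub 2 (transfer `C⁺ = X`, the route TARGET stmt-NavierStokesRegularity-4050; open — the
hardest stub).** By Part B below no line concluding the crux can replace it by anything weaker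
(given the KNSS gauge bounds, `LL7 → X`). It is discharged by whatever closes item 4050. -/
theorem stub_typeIAncientLiouville : TypeIAncientLiouville := by
  sorry

/-- A tempered linearised solution about a background that VANISHES on `t < 0` is a tempered
linearised solution about the zero background. Pure rewriting. -/
theorem temperedLinearised_of_background_eq_zero {u v : ℝ → ℝ³ → ℝ³} {q : ℝ → ℝ³ → ℝ}
    (h : IsTemperedLinearisedNSSolution u v q) (hu : ∀ t < 0, ∀ x, u t x = 0) :
    IsTemperedLinearisedNSSolution (0 : ℝ → ℝ³ → ℝ³) v q := by
  refine ⟨h.smooth_velocity, h.smooth_pressure, h.growth, h.divFree, fun t ht x => ?_⟩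
  have hut : u t = fun _ => 0 := funext fun y => hu t ht y
  have h5 := h.momentum t ht x
  rw [hut] at h5
  simpa [convect] using h5

/-- **Composition of the line (proved).** Anchor + target ⇒ the crux in its structured form. -/
theorem linearLiouvilleSeven_of_parts (hA : TemperedStokesLiouville) (hX : TypeIAncientLiouville) :
    ∀ (C : ℝ) (u : ℝ → ℝ³ → ℝ³), IsTypeIAncientMild C u →
      ∀ (v : Fin 7 → ℝ → ℝ³ → ℝ³) (q : Fin 7 → ℝ → ℝ³ → ℝ),
        (∀ i, IsTemperedLinearisedNSSolution u (v i) (q i)) →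
        ∃ c : Fin 7 → ℝ, c ≠ 0 ∧ ∀ t < 0, ∃ b : ℝ³, ∀ x, ∑ i, c i • v i t x = b := by
  intro C u hu v q hvq
  have hu0 : ∀ t < 0, ∀ x, u t x = 0 := hX C u (isTypeIAncientMild_iff.1 hu)
  have hv0 : ∀ i, IsTemperedLinearisedNSSolution (0 : ℝ → ℝ³ → ℝ³) (v i) (q i) := fun i =>
    temperedLinearised_of_background_eq_zero (hvq i) hu0
  refine ⟨Pi.single 0 1, ?_, fun t ht => ?_⟩
  · intro h
    have := congr_fun h 0
    simp at this
  · obtain ⟨b, hb⟩ := hA (v 0) (q 0) (hv0 0) t ht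
    refine ⟨b, fun x => ?_⟩
    simp [Pi.single_apply, ite_smul, Finset.sum_ite_eq', hb x]

/-- **The skeleton concludes the crux BY NAME**: `LinearLiouvilleSeven` (route `SymmetryModuliCount`,
stmt-NavierStokesRegularity-4054) from the registered stubs. -/
theorem LinearLiouvilleSeven_of : LinearLiouvilleSeven :=
  linearLiouvilleSeven_iff.2
    (linearLiouvilleSeven_of_parts stub_temperedStokesLiouville stub_typeIAncientLiouville)

/-! ## Part B — the collapse `LL7 → X` (the idea's theorem), as a checked reduction -/

/-- The **modulated Galilean mode** along the fixed vector `e` with modulation `φ`: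
`v_φ(t, x) = φ'(t) e − φ(t) ∂ₑu(t, x)`. -/
def galileanMode (φ : ℝ → ℝ) (e : ℝ³) (u : ℝ → ℝ³ → ℝ³) (t : ℝ) (x : ℝ³) : ℝ³ :=
  deriv φ t • e - φ t • fderiv ℝ (u t) x e

/-- The pressure of the modulated Galilean mode: `q_φ(t, x) = −φ''(t) ⟪e, x⟫ − φ(t) ∂ₑp(t, x)`. -/
def galileanPressure (φ : ℝ → ℝ) (e : ℝ³) (p : ℝ → ℝ³ → ℝ) (t : ℝ) (x : ℝ³) : ℝ :=
  -(iteratedDeriv 2 φ t * ⟪e, x⟫) - φ t * fderiv ℝ (p t) x e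

/-- **Tempered modulations**: `φ` smooth on `t < 0` with `|φ| ≤ M`, `√(−t)|φ'| ≤ M`,
`(−t)^{3/2}|φ''| ≤ M`. -/
def IsTemperedModulation (φ : ℝ → ℝ) : Prop :=
  ContDiffOn ℝ (⊤ : ℕ∞) φ (Iio 0) ∧
    ∃ M : ℝ, ∀ t < 0, |φ t| ≤ M ∧ Real.sqrt (-t) * |deriv φ t| ≤ M ∧
      Real.sqrt (-t) ^ 3 * |iteratedDeriv 2 φ t| ≤ M

/-- **Gauge pair**: `p` is a smooth pressure for which `(u, p)` solves Navier–Stokes classically on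
`t < 0` (tree convention `∂ₜu + (u·∇)u = Δu − ∇p`), with the scale-invariant bounds
`‖∇u‖ ≤ C₁/(−t)`, `‖∇p‖ ≤ C₃/√(−t)³`. -/
def IsGaugePair (u : ℝ → ℝ³ → ℝ³) (p : ℝ → ℝ³ → ℝ) (C₁ C₃ : ℝ) : Prop :=
  ContDiffOn ℝ (⊤ : ℕ∞) (uncurry p) (Iio 0 ×ˢ univ) ∧
    (∀ t < 0, ∀ x, timeDeriv u t x + convect (u t) (u t) x = Δ (u t) x - gradient (p t) x) ∧
    (∀ t < 0, ∀ x, ‖fderiv ℝ (u t) x‖ ≤ C₁ / (-t)) ∧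
    (∀ t < 0, ∀ x, ‖gradient (p t) x‖ ≤ C₃ / Real.sqrt (-t) ^ 3)

/-- **(B1) Gauge bounds** (size M–L; KNSS2009 Prop. 4.1 with (4.6) = tree theorem
`KNSS2009_prop41_mild_holds`, the classical pressure of
`IsTypeIAncientMild.exists_isClassicalNSSolutionOn_Ioo` (Fabes–Jones–Rivière) normalised by
`p(t, 0) = 0`; `∇p = Δu − ∂ₜu − (u·∇)u`): every element of `𝒜_C` carries a gauge pair. Kept as a
NAMED hypothesis of the collapse (not a registered stub). -/
def GaugeBounds : Prop :=
  ∀ (C : ℝ) (u : ℝ → ℝ³ → ℝ³), IsTypeIAncientMild C u →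
    ∃ (p : ℝ → ℝ³ → ℝ) (C₁ C₃ : ℝ), IsGaugePair u p C₁ C₃

/-- **(B2) Modulated Galilean modes are tempered linearised solutions.** -/
def GalileanModesTempered : Prop :=
  ∀ (C : ℝ) (u : ℝ → ℝ³ → ℝ³) (p : ℝ → ℝ³ → ℝ) (C₁ C₃ : ℝ), IsTypeIAncientMild C u →
    IsGaugePair u p C₁ C₃ → ∀ φ : ℝ → ℝ, IsTemperedModulation φ → ∀ e : ℝ³,
      IsTemperedLinearisedNSSolution u (galileanMode φ e u) (galileanPressure φ e p)

/-- **(B3) Seven independent tempered modulations.** -/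
def SevenIndependentModulations : Prop :=
  ∃ φ : Fin 7 → ℝ → ℝ, (∀ k, IsTemperedModulation (φ k)) ∧
    ∀ c : Fin 7 → ℝ, c ≠ 0 → ∀ t₀ < 0, ∀ ε > 0, ∃ t < 0, |t - t₀| < ε ∧ ∑ k, c k * φ k t ≠ 0

/-- **(B4) A slice-constant modulated combination forces flatness along `e`.** -/
def SliceConstantModesForceFlat : Prop :=
  ∀ (C : ℝ) (u : ℝ → ℝ³ → ℝ³), IsTypeIAncientMild C u →
    ∀ (e : ℝ³) (φ : Fin 7 → ℝ → ℝ) (c : Fin 7 → ℝ),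
      (∀ t₀ < 0, ∀ ε > 0, ∃ t < 0, |t - t₀| < ε ∧ ∑ k, c k * φ k t ≠ 0) →
      (∀ t < 0, ∃ b : ℝ³, ∀ x, ∑ k, c k • galileanMode (φ k) e u t x = b) →
      ∀ t < 0, ∀ x, fderiv ℝ (u t) x e = 0

/-- **Stub B2a (registered; worker-sized, M): regularity, growth and incompressibility of a
modulated Galilean mode.** For `u, p` jointly smooth on `(−∞,0) × ℝ³` with `div u = 0`,
`‖Du‖ ≤ C₁/(−t)`, `‖∇p‖ ≤ C₃/√(−t)³`, and a tempered modulation `φ` (smooth on `t < 0`, `|φ| ≤ M`,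
`√(−t)|φ'| ≤ M`, `√(−t)³|φ''| ≤ M`), the pair `v = φ'e − φ∂ₑu`, `q = −φ''⟪e,x⟫ − φ∂ₑp` is jointly
smooth, tempered, and `div v = 0`. -/
theorem stub_galileanModeRegular :
    ∀ (u : ℝ → EuclideanSpace ℝ (Fin 3) → EuclideanSpace ℝ (Fin 3))
      (p : ℝ → EuclideanSpace ℝ (Fin 3) → ℝ) (φ : ℝ → ℝ) (e : EuclideanSpace ℝ (Fin 3))
      (C₁ C₃ M : ℝ),
      ContDiffOn ℝ (⊤ : ℕ∞) (Function.uncurry u) (Set.Iio 0 ×ˢ Set.univ) →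
      ContDiffOn ℝ (⊤ : ℕ∞) (Function.uncurry p) (Set.Iio 0 ×ˢ Set.univ) →
      (∀ t < 0, Literature.Analysis.FluidPDE.VectorCalculus.IsDivFree (u t)) →
      (∀ t < 0, ∀ x, ‖fderiv ℝ (u t) x‖ ≤ C₁ / (-t)) →
      (∀ t < 0, ∀ x, ‖gradient (p t) x‖ ≤ C₃ / Real.sqrt (-t) ^ 3) →
      ContDiffOn ℝ (⊤ : ℕ∞) φ (Set.Iio 0) →
      (∀ t < 0, |φ t| ≤ M ∧ Real.sqrt (-t) * |deriv φ t| ≤ M ∧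
        Real.sqrt (-t) ^ 3 * |iteratedDeriv 2 φ t| ≤ M) →
      ContDiffOn ℝ (⊤ : ℕ∞)
          (Function.uncurry fun t x => deriv φ t • e - φ t • fderiv ℝ (u t) x e)
          (Set.Iio 0 ×ˢ Set.univ) ∧
        ContDiffOn ℝ (⊤ : ℕ∞)
          (Function.uncurry fun t x => -(iteratedDeriv 2 φ t * inner ℝ e x) - φ t * fderiv ℝ (p t) x e)
          (Set.Iio 0 ×ˢ Set.univ) ∧
        (∃ K : ℝ, ∀ t < 0, ∀ x,
          ‖(fun t x => deriv φ t • e - φ t • fderiv ℝ (u t) x e) t x‖ ≤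
              K / Real.sqrt (-t) + K * (1 + ‖x‖) / (-t) ∧
            |(fun t x => -(iteratedDeriv 2 φ t * inner ℝ e x) - φ t * fderiv ℝ (p t) x e) t x| ≤
              K / (-t) + K * (1 + ‖x‖) / Real.sqrt (-t) ^ 3) ∧
        (∀ t < 0, Literature.Analysis.FluidPDE.VectorCalculus.IsDivFree
          ((fun t x => deriv φ t • e - φ t • fderiv ℝ (u t) x e) t)) := by
  sorry

/-- **Stub B2b (registered; worker-sized, M): the Galilean Jacobi identity.** For `u, p` jointly
smooth on `(−∞,0) × ℝ³` solving Navier–Stokes classically (`∂ₜu + (u·∇)u = Δu − ∇p`) and `φ`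
smooth on `t < 0`, the pair `v = φ'e − φ∂ₑu`, `q = −φ''⟪e,x⟫ − φ∂ₑp` solves the linearised momentum
equation `∂ₜv + (u·∇)v + (v·∇)u = Δv − ∇q` on `t < 0`
(`= φ''e − φ ∂ₑ[∂ₜu + (u·∇)u − Δu + ∇p] − φ''e = 0`). -/
theorem stub_galileanModeMomentum :
    ∀ (u : ℝ → EuclideanSpace ℝ (Fin 3) → EuclideanSpace ℝ (Fin 3))
      (p : ℝ → EuclideanSpace ℝ (Fin 3) → ℝ) (φ : ℝ → ℝ) (e : EuclideanSpace ℝ (Fin 3)),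
      ContDiffOn ℝ (⊤ : ℕ∞) (Function.uncurry u) (Set.Iio 0 ×ˢ Set.univ) →
      ContDiffOn ℝ (⊤ : ℕ∞) (Function.uncurry p) (Set.Iio 0 ×ˢ Set.univ) →
      (∀ t < 0, ∀ x, Literature.Analysis.FluidPDE.timeDeriv u t x +
        Literature.Analysis.FluidPDE.convect (u t) (u t) x =
          Laplacian.laplacian (u t) x - gradient (p t) x) →
      ContDiffOn ℝ (⊤ : ℕ∞) φ (Set.Iio 0) →
      ∀ t < 0, ∀ x,
        Literature.Analysis.FluidPDE.timeDeriv (fun t x => deriv φ t • e - φ t • fderiv ℝ (u t) x e) t x +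
          Literature.Analysis.FluidPDE.convect (u t)
            ((fun t x => deriv φ t • e - φ t • fderiv ℝ (u t) x e) t) x +
          Literature.Analysis.FluidPDE.convect
            ((fun t x => deriv φ t • e - φ t • fderiv ℝ (u t) x e) t) (u t) x =
        Laplacian.laplacian ((fun t x => deriv φ t • e - φ t • fderiv ℝ (u t) x e) t) x -
          gradient ((fun t x => -(iteratedDeriv 2 φ t * inner ℝ e x) - φ t * fderiv ℝ (p t) x e) t) x := by
  sorry

/-- **Stub B3 (registered; worker-sized, S–M): seven independent tempered modulations.** Witness
`φ_k(t) = (1 + √(−t))^{-(k+1)}`; `Σ c_k s^{-(k+1)} = s^{-7} P(s)` with `P ≠ 0` of degree `≤ 6` has at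
most six zeros, so every neighbourhood of every `t₀ < 0` contains a time where the combination is
nonzero. -/
theorem stub_sevenIndependentModulations :
    ∃ φ : Fin 7 → ℝ → ℝ,
      (∀ k, ContDiffOn ℝ (⊤ : ℕ∞) (φ k) (Set.Iio 0) ∧
        ∃ M : ℝ, ∀ t < 0, |φ k t| ≤ M ∧ Real.sqrt (-t) * |deriv (φ k) t| ≤ M ∧
          Real.sqrt (-t) ^ 3 * |iteratedDeriv 2 (φ k) t| ≤ M) ∧
      ∀ c : Fin 7 → ℝ, c ≠ 0 → ∀ t₀ < 0, ∀ ε > 0, ∃ t < 0, |t - t₀| < ε ∧ ∑ k, c k * φ k t ≠ 0 := by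
  sorry

/-- **Stub B4 (registered; worker-sized, S–M): a slice-constant modulated combination forces
flatness along `e`.** `Σ c_k (φ_k' e − φ_k ∂ₑu) = α(t) e − ψ(t) ∂ₑu(t,·)` with `ψ = Σ c_k φ_k`; where
`ψ(t) ≠ 0` the slice `∂ₑu(t,·)` is a constant `w`, and `θ ↦ u(t, x + θe)` is bounded (`‖u‖ ≤ C/√(−t)`)
with constant derivative `w`, so `w = 0`; such `t` accumulate at every `t < 0` and
`t ↦ ∂ₑu(t, x)` is continuous (joint smoothness). Only smoothness and the Type-I bound are used. -/
theorem stub_sliceConstantModesForceFlat :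
    ∀ (C : ℝ) (u : ℝ → EuclideanSpace ℝ (Fin 3) → EuclideanSpace ℝ (Fin 3)),
      ContDiffOn ℝ (⊤ : ℕ∞) (Function.uncurry u) (Set.Iio 0 ×ˢ Set.univ) →
      Literature.Analysis.FluidPDE.HasTypeITimeDecay C u →
      ∀ (e : EuclideanSpace ℝ (Fin 3)) (φ : Fin 7 → ℝ → ℝ) (c : Fin 7 → ℝ),
        (∀ t₀ < 0, ∀ ε > 0, ∃ t < 0, |t - t₀| < ε ∧ ∑ k, c k * φ k t ≠ 0) →
        (∀ t < 0, ∃ b : EuclideanSpace ℝ (Fin 3), ∀ x,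
          ∑ k, c k • (deriv (φ k) t • e - φ k t • fderiv ℝ (u t) x e) = b) →
        ∀ t < 0, ∀ x, fderiv ℝ (u t) x e = 0 := by
  sorry

/-- (B2) from the registered stubs B2a, B2b. -/
theorem galileanModesTempered : GalileanModesTempered := by
  intro C u p C₁ C₃ hu hg φ hφ e
  obtain ⟨hp, hNS, hC₁, hC₃⟩ := hg
  obtain ⟨hφs, M, hM⟩ := hφ
  obtain ⟨h1, h2, h3, h4⟩ :=
    stub_galileanModeRegular u p φ e C₁ C₃ M hu.contDiffOn hp (fun t ht => hu.isDivFree ht) hC₁ hC₃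
      hφs hM
  have h5 := stub_galileanModeMomentum u p φ e hu.contDiffOn hp hNS hφs
  exact (isTemperedLinearisedNSSolution_iff u _ _).2 ⟨h1, h2, h3, h4, h5⟩

/-- (B3) from the registered stub B3. -/
theorem sevenIndependentModulations : SevenIndependentModulations :=
  stub_sevenIndependentModulations

/-- (B4) from the registered stub B4. -/
theorem sliceConstantModesForceFlat : SliceConstantModesForceFlat := by
  intro C u hu e φ c hdense hconst
  exact stub_sliceConstantModesForceFlat C u hu.contDiffOn hu.hasTypeITimeDecay e φ c hdense hconst

/-- **Flat elements of `𝒜_C` vanish** (proved): `∇u(t, ·) ≡ 0` makes every slice constant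
(`is_const_of_fderiv_eq_zero`), and the KNSS gauge together with the Type-I decay kills
slice-constant elements (`IsTypeIAncientMild.eq_zero_of_slice_const`). -/
theorem eq_zero_of_fderiv_eq_zero {C : ℝ} {u : ℝ → ℝ³ → ℝ³} (hu : IsTypeIAncientMild C u)
    (hflat : ∀ t < 0, ∀ x, fderiv ℝ (u t) x = 0) : ∀ t < 0, ∀ x, u t x = 0 := by
  have hub : ∀ t < 0, ∀ x, u t x = u t 0 := fun t ht x =>
    is_const_of_fderiv_eq_zero ((hu.contDiff_slice ht).differentiable (by simp)) (hflat t ht) x 0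
  intro t ht x
  exact hu.eq_zero_of_slice_const (b := fun s => u s 0) hub ht x

/-- **THE COLLAPSE (checked reduction): `LL7 → X` given the gauge bounds.** -/
theorem typeIAncientLiouville_of_linearLiouvilleSeven (hG : GaugeBounds)
    (hL : LinearLiouvilleSeven) : TypeIAncientLiouville := by
  intro C u hu'
  have hu : IsTypeIAncientMild C u := isTypeIAncientMild_iff.2 hu'
  obtain ⟨p, C₁, C₃, hg⟩ := hG C u hu
  obtain ⟨φ, hφ, hind⟩ := sevenIndependentModulations
  rw [linearLiouvilleSeven_iff] at hL
  have hdir : ∀ e : ℝ³, ∀ t < 0, ∀ x, fderiv ℝ (u t) x e = 0 := by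
    intro e
    obtain ⟨c, hc, hconst⟩ := hL C u hu (fun k => galileanMode (φ k) e u)
      (fun k => galileanPressure (φ k) e p)
      (fun k => galileanModesTempered C u p C₁ C₃ hu hg (φ k) (hφ k) e)
    exact sliceConstantModesForceFlat C u hu e φ c (hind c hc) hconst
  have hflat : ∀ t < 0, ∀ x, fderiv ℝ (u t) x = 0 := fun t ht x =>
    ContinuousLinearMap.ext fun e => by simpa using hdir e t ht x
  exact eq_zero_of_fderiv_eq_zero hu hflat

/-- **`LL7 ⇔ X` given the KNSS gauge bounds (B1)**: the crux is the target in costume. -/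
theorem linearLiouvilleSeven_iff_typeIAncientLiouville (hG : GaugeBounds) :
    LinearLiouvilleSeven ↔ TypeIAncientLiouville :=
  ⟨typeIAncientLiouville_of_linearLiouvilleSeven hG,
    fun hX => linearLiouvilleSeven_iff.2 (linearLiouvilleSeven_of_parts stub_temperedStokesLiouville hX)⟩

end Summit.NavierStokesRegularity.NavierStokesRegularity.Cruxes.LinearLiouvilleSeven.GalileanCollapse

end
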